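import Summits.ResolutionOfSingularities.ResolutionOfSingularities.Theorems.MarkedTransferCampaignW46MohWindowShadeFormalStatement
import Summits.ResolutionOfSingularities.ResolutionOfSingularities.Theorems.MarkedTransferCampaignW46MohWindowShadeFormalAnchor
import Summits.ResolutionOfSingularities.ResolutionOfSingularities.Theorems.MarkedTransferCampaignW46MohWindowShadePolyPersistence
import Literature.AlgebraicGeometry.Resolution.FiniteDeterminacyProofs
import Literature.RingTheory.MvPowerSeries.FiniteColength
import Mathlib.RingTheory.MvPowerSeries.Trunc
import HarnessLib

/-!
# [OURS · L1 W4.6 rung (iii-2)] From POWER-SERIES to POLYNOMIAL formal anchors by finite determinacy: a formally purely inseparable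
# window germ `z^p + F(u₀, u₁)`, `F ∈ K⟦u₀, u₁⟧`, with ISOLATED SURFACE SINGULARITY (finite Tjurina number) is formally-polynomial

Cell `res-hironaka`, LADDER-RESOLUTION rung L (D-0089), slot W4.6 rung (iii); seat res-L1-s46-pv-6 (gen 5). Host route MarkedTransfer,
`--supports stmt-ResolutionOfSingularities-16155 --as helper`; kind proof (no definition).

WHY. res-D-pv-008 AS s46-pv-14's clause (R1) asks for `e(J 𝒪̂_ξ) = (z^p + F)` with `F` a POWER SERIES free of `z`; this seat's kernel
termination theorem and its formal entrance door (gen 5) speak about POLYNOMIAL `F`. For germs with an isolated SURFACE singularity — the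
classical hypothesis (Hauser 2010, Hauser–Wagner 2014) — the two agree: by CONTACT FINITE DETERMINACY in arbitrary characteristic
(Boubakri–Greuel–Markwig 2012, Thm. 2.1, PROVED in the tree: `Literature.AlgebraicGeometry.Resolution.BoubakriGreuelMarkwig.Thm21_holds`,
here through `isContactDetermined_of_pow_le`, valid over ANY field) the germ `z^p + F(u)` is contact-equivalent to its jet `z^p + F_{≤d}(u)`
for `d` large, and composing the Cohen coordinates with the contact automorphism gives a formally-POLYNOMIAL anchor with the cleaned polynomial
`F_{≤d}`, `p < ord F_{≤d} = ord F < 2p`.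

WHAT. `formalPolyAt_of_formalSeries` (ring level): Cohen coordinates `e : R̂ ≃+* K⟦z, u₀, u₁⟧`, `I = (f₀)`, `e f₀ = w · (z^p + F(u₀, u₁))` with
`F ∈ K⟦y₀, y₁⟧` having no `p`-th power monomials and `p < ord F < 2p`, and the Tjurina algebra of `z^p + F(u)` finite-dimensional over `K`
(`BoubakriGreuelMarkwig.IsIsolatedHypersurface`, read after renaming `Option (Fin 2) ≃ Fin 3`) ⟹ `MohWindowSurfaceFormalPolyAt p K R I`
(p531101). Consequently every rung proved for `Regime.mohWindowSurfaceFormalPoly` (p532859: algebraically closed `K`; every finite / perfect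
field with rational singular points) holds verbatim for the regime «formally purely inseparable with power-series `F`, window, isolated
surface singularity at every singular point» (typed with its closers in `…MohWindowShadeFormalSeriesStatement.lean`).

HONEST FRAMING. Nothing here is a statement of H. Hironaka's manuscript [Hironaka2017] (Th. 16.6 p.84 — scope only, under adjudication) and
nothing asserts that any statement of it holds. AI-written; AI review is weaker than expert review. No `sorry`; axioms standard. References:
Y. Boubakri, G.-M. Greuel, T. Markwig, Rev. Mat. Complut. 25 (2012), Thm. 2.1 [BoubakriGreuelMarkwig2010]; H. Hauser, Bull. AMS 47 (2010) §F
[Hauser2010]. [folklore]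
-/

noncomputable section

set_option linter.dupNamespace false -- mandated namespace of this single-conjunct summit

open IsLocalRing

namespace Summit.ResolutionOfSingularities.ResolutionOfSingularities.Theorems

namespace CampaignW46

namespace MohWindowShadeFormalSeries

open Literature.AlgebraicGeometry.Resolution
open Literature.AlgebraicGeometry.Resolution.Hauser2010
open Literature.AlgebraicGeometry.Resolution.BoubakriGreuelMarkwig
open Literature.Barriers.ResolutionOfSingularities.HauserPerlega (natCast_le_ordZero_iff)
open Literature.Barriers.ResolutionOfSingularities (ordZero_le_of_coeff_ne_zero)
open Literature.RingTheory.MvPowerSeries.Jets (mem_maximalIdeal_pow_of_coeff_eq_zero coeff_eq_zero_of_mem_maximalIdeal_pow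
  mem_maximalIdeal_iff_constantCoeff_eq_zero exists_maximalIdeal_pow_le_of_finite_quotient mem_maximalIdeal_pow_of_le_order)
open CampaignW46.FormalChart (ringEquiv_mem_maximalIdeal_pow)

variable {p : ℕ} [hp : Fact p.Prime] {K : Type} [Field K]

/-! ## §1 Jets of a power series in two letters -/

omit hp in
/-- The jet polynomial agrees with the series below the truncation degree. [folklore] -/
theorem coeff_truncTotal_of_lt (N : ℕ) (F : MvPowerSeries (Fin 2) K) {d : Fin 2 →₀ ℕ} (hd : d.degree < N) :
    MvPolynomial.coeff d (MvPowerSeries.truncTotal N F) = MvPowerSeries.coeff d F :=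
  MvPowerSeries.coeff_truncTotal F hd

omit hp in
/-- The remainder `F − F_{<N}` lies in `𝔪^N`. [folklore] -/
theorem sub_truncTotal_mem_pow (N : ℕ) (F : MvPowerSeries (Fin 2) K) :
    F - (MvPowerSeries.truncTotal N F : MvPolynomial (Fin 2) K) ∈ maximalIdeal (MvPowerSeries (Fin 2) K) ^ N := by
  refine mem_maximalIdeal_pow_of_coeff_eq_zero fun e he => ?_
  rw [map_sub, MvPolynomial.coeff_coe, MvPowerSeries.coeff_truncTotal F he, sub_self]

omit hp in
/-- A placed series with vanishing coefficients below degree `N` lies in `𝔪^N` of `K⟦z, u₀, u₁⟧`. [folklore] -/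
theorem rename_mem_pow_of_mem_pow {N : ℕ} {H : MvPowerSeries (Fin 2) K} (hH : H ∈ maximalIdeal (MvPowerSeries (Fin 2) K) ^ N) :
    MvPowerSeries.rename (some : Fin 2 → Option (Fin 2)) H ∈ maximalIdeal (MvPowerSeries (Option (Fin 2)) K) ^ N := by
  refine mem_maximalIdeal_pow_of_coeff_eq_zero fun x hx => ?_
  by_cases hmem : x ∈ Set.range (Finsupp.mapDomain (some : Fin 2 → Option (Fin 2)))
  · obtain ⟨y, rfl⟩ := hmem
    have hy : y.degree < N := by rwa [Finsupp.degree_mapDomain] at hx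
    have hemb : Finsupp.mapDomain (some : Fin 2 → Option (Fin 2)) y =
        Finsupp.embDomain ⟨(some : Fin 2 → Option (Fin 2)), Option.some_injective _⟩ y := by
      rw [Finsupp.embDomain_eq_mapDomain]; rfl
    rw [hemb]
    change MvPowerSeries.coeff _ (MvPowerSeries.rename (⟨(some : Fin 2 → Option (Fin 2)), Option.some_injective _⟩ : Fin 2 ↪ Option (Fin 2)) H) = 0
    rw [MvPowerSeries.coeff_embDomain_rename]
    exact coeff_eq_zero_of_mem_maximalIdeal_pow hH hy
  · exact MvPowerSeries.coeff_rename_eq_zero _ H hmem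

omit hp in
/-- The jet of a series without `p`-th power monomials is CLEANED. [cite: Hauser2010, §G (cleaning of p-th power monomials)] -/
theorem deletePthPowers_truncTotal (N : ℕ) {F : MvPowerSeries (Fin 2) K}
    (hclean : ∀ d : Fin 2 →₀ ℕ, IsPthPowerExponent p d → MvPowerSeries.coeff d F = 0) :
    deletePthPowers p (MvPowerSeries.truncTotal N F) = MvPowerSeries.truncTotal N F := by
  classical
  refine MohWindowShadeCleaning.deletePthPowers_eq_self_of_forall p fun d hd hP => ?_
  rw [MvPolynomial.mem_support_iff, MvPowerSeries.coeff_truncTotal_eq_ite] at hd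
  split_ifs at hd with h
  · exact hd (hclean d hP)
  · exact hd rfl

omit hp in
/-- The jet at a level `N > ord F` has the order of the series: `ord F ≤ ord₀ F_{<N}` always, and a lowest monomial of `F` survives.
[folklore] -/
theorem ordZero_truncTotal {N : ℕ} {F : MvPowerSeries (Fin 2) K} {a b : ℕ} (ha : (a : ℕ∞) < F.order) (hb : F.order < (b : ℕ))
    (hbN : b ≤ N) :
    (a : ℕ∞) < ordZero (MvPowerSeries.truncTotal N F) ∧ ordZero (MvPowerSeries.truncTotal N F) < (b : ℕ) := by
  classical
  constructor
  · -- every monomial of the jet is a monomial of `F`, of degree `> a`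
    have h1 : ((a + 1 : ℕ) : ℕ∞) ≤ ordZero (MvPowerSeries.truncTotal N F) := by
      rw [natCast_le_ordZero_iff]
      intro d hd
      rw [MvPolynomial.mem_support_iff, MvPowerSeries.coeff_truncTotal_eq_ite] at hd
      split_ifs at hd with h
      · have hle := MvPowerSeries.order_le hd
        by_contra hlt
        push Not at hlt
        have : (d.degree : ℕ∞) ≤ a := by exact_mod_cast Nat.lt_succ_iff.mp hlt
        exact absurd (lt_of_le_of_lt (hle.trans this) ha) (lt_irrefl _)
      · exact absurd rfl hd
    exact lt_of_lt_of_le (by exact_mod_cast Nat.lt_succ_self a) h1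
  · -- a lowest monomial of `F` has degree `ord F < b ≤ N`, so it survives in the jet
    have hfin : F.order.toNat = F.order := by
      apply ENat.coe_toNat
      intro htop
      rw [htop] at hb
      exact absurd hb (not_lt.mpr le_top)
    obtain ⟨d, hd, hdeg⟩ := MvPowerSeries.exists_coeff_ne_zero_and_order hfin
    have hdb : d.degree < b := by
      have : (d.degree : ℕ∞) < b := by rw [hdeg]; exact hb
      exact_mod_cast this
    have hcoeff : MvPolynomial.coeff d (MvPowerSeries.truncTotal N F) ≠ 0 := by
      rw [MvPowerSeries.coeff_truncTotal F (lt_of_lt_of_le hdb hbN)]; exact hd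
    exact lt_of_le_of_lt (ordZero_le_of_coeff_ne_zero _ d hcoeff) (by exact_mod_cast hdb : (d.degree : ℕ∞) < (b : ℕ))

/-! ## §2 Contact determinacy, read in `K⟦z, u₀, u₁⟧` indexed by `Option (Fin 2)` -/

/-- The renaming `Option (Fin 2) ≃ Fin 3` used to read Boubakri–Greuel–Markwig (stated for `K⟦x₁, …, xₙ⟧`). [folklore] -/
def optionFinTwoEquiv : Option (Fin 2) ≃ Fin 3 := (finSuccEquiv 2).symm

omit hp in
/-- **Contact equivalence to a jet, pulled back along the renaming.** If `G ∈ K⟦z, u₀, u₁⟧` and `J` have the same `k`-jet and the renamed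
`G` is contact `k`-determined, then `G = u · ψ J` for a `K`-algebra automorphism `ψ` of `K⟦z, u₀, u₁⟧` and a unit `u`.
[cite: BoubakriGreuelMarkwig2010, §1 (p. 3)] -/
theorem exists_unit_algEquiv_of_isContactDetermined {k : ℕ} {G J : MvPowerSeries (Option (Fin 2)) K}
    (hdet : IsContactDetermined k (MvPowerSeries.renameEquiv K optionFinTwoEquiv G))
    (hjet : G - J ∈ maximalIdeal (MvPowerSeries (Option (Fin 2)) K) ^ (k + 1)) :
    ∃ (ψ : MvPowerSeries (Option (Fin 2)) K ≃ₐ[K] MvPowerSeries (Option (Fin 2)) K) (u : MvPowerSeries (Option (Fin 2)) K),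
      IsUnit u ∧ G = u * ψ J := by
  set ρ := MvPowerSeries.renameEquiv K optionFinTwoEquiv with hρ
  have hjet' : HaveSameJet k (ρ G) (ρ J) := by
    change ρ G - ρ J ∈ _
    rw [← map_sub]
    exact ringEquiv_mem_maximalIdeal_pow ρ.toRingEquiv hjet
  obtain ⟨φ, u, hGu⟩ := hdet (ρ J) hjet'
  refine ⟨(ρ.trans φ).trans ρ.symm, ρ.symm (u : MvPowerSeries (Fin 3) K), (Units.isUnit u).map ρ.symm, ?_⟩
  apply ρ.injective
  rw [map_mul, AlgEquiv.apply_symm_apply, AlgEquiv.trans_apply, AlgEquiv.trans_apply, AlgEquiv.apply_symm_apply]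
  exact hGu

/-! ## §3 The reduction -/

/-- **A formally purely inseparable window germ with power-series `F` and isolated surface singularity is formally-polynomial.**
[OURS · L1 W4.6 rung (iii-2)] NOT a statement of the manuscript. Ring level: `e : R̂ ≃+* K⟦z, u₀, u₁⟧`, `I = (f₀)`, `e f₀ = w · (z^p + F(u₀, u₁))`,
`F ∈ K⟦y₀, y₁⟧` without `p`-th power monomials, `p < ord F < 2p`, and the Tjurina algebra of `z^p + F(u)` finite over `K` ⟹
`MohWindowSurfaceFormalPolyAt p K R I`, with the jet `F_{<N}` (`N = max (2·M + 2, 2p)`, `𝔪^M ⊆` Tjurina ideal) as model polynomial and the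
Cohen coordinates `e` followed by the inverse contact automorphism. [cite: BoubakriGreuelMarkwig2010, Thm. 2.1] [cite: Hauser2010, §F (setting f = x^p + y^r g)] -/
theorem formalPolyAt_of_formalSeries {R : Type} [CommRing R] [IsLocalRing R] {I : Ideal R}
    (e : AdicCompletion (maximalIdeal R) R ≃+* MvPowerSeries (Option (Fin 2)) K) (f₀ : R) (w : MvPowerSeries (Option (Fin 2)) K)
    (hw : IsUnit w) (F : MvPowerSeries (Fin 2) K)
    (hclean : ∀ d : Fin 2 →₀ ℕ, IsPthPowerExponent p d → MvPowerSeries.coeff d F = 0)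
    (hpF : (p : ℕ∞) < F.order) (hF2 : F.order < (2 * p : ℕ)) (hI : I = Ideal.span {f₀})
    (hE : e (algebraMap R (AdicCompletion (maximalIdeal R) R) f₀) =
      w * (MvPowerSeries.X none ^ p + MvPowerSeries.rename (some : Fin 2 → Option (Fin 2)) F))
    (hτ : IsIsolatedHypersurface (MvPowerSeries.renameEquiv K optionFinTwoEquiv
      (MvPowerSeries.X none ^ p + MvPowerSeries.rename (some : Fin 2 → Option (Fin 2)) F))) :
    MohWindowSurfaceFormalPolyAt p K R I := by
  classical
  set G : MvPowerSeries (Option (Fin 2)) K :=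
    MvPowerSeries.X none ^ p + MvPowerSeries.rename (some : Fin 2 → Option (Fin 2)) F with hG
  set ρ := MvPowerSeries.renameEquiv K optionFinTwoEquiv with hρ
  have hp2 : 2 ≤ p := hp.out.two_le
  -- `F ∈ 𝔪^(p+1)`, `G ∈ 𝔪^p`
  have hFmem : F ∈ maximalIdeal (MvPowerSeries (Fin 2) K) ^ (p + 1) :=
    mem_maximalIdeal_pow_of_le_order (Order.add_one_le_of_lt hpF)
  have hXp : (MvPowerSeries.X none : MvPowerSeries (Option (Fin 2)) K) ^ p ∈ maximalIdeal (MvPowerSeries (Option (Fin 2)) K) ^ p :=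
    Ideal.pow_mem_pow (mem_maximalIdeal_iff_constantCoeff_eq_zero.mpr (MvPowerSeries.constantCoeff_X _)) p
  have hGmem : G ∈ maximalIdeal (MvPowerSeries (Option (Fin 2)) K) ^ p :=
    Ideal.add_mem _ hXp (Ideal.pow_le_pow_right (Nat.le_succ p) (rename_mem_pow_of_mem_pow hFmem))
  -- `G ≠ 0`: its coefficient at `z^p` is `1`
  have hGne : G ≠ 0 := by
    intro h0
    have h1 : MvPowerSeries.coeff (Finsupp.single (none : Option (Fin 2)) p) G = 0 := by rw [h0, map_zero]
    have h2 : MvPowerSeries.coeff (Finsupp.single (none : Option (Fin 2)) p)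
        (MvPowerSeries.rename (some : Fin 2 → Option (Fin 2)) F) = 0 := by
      refine MvPowerSeries.coeff_rename_eq_zero _ F ?_
      rintro ⟨y, hy⟩
      have := Finsupp.ext_iff.mp hy none
      rw [Finsupp.mapDomain_notin_range, Finsupp.single_eq_same] at this
      · exact hp.out.ne_zero this.symm
      · rintro ⟨l, hl⟩; exact Option.some_ne_none l hl
    rw [hG, map_add, MvPowerSeries.coeff_X_pow, if_pos rfl, h2, add_zero] at h1
    exact one_ne_zero h1
  -- the renamed germ and its Tjurina ideal: `𝔪^M ≤ tj(ρ G)`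
  have hρGne : ρ G ≠ 0 := fun h => hGne (by simpa using h)
  have hρG2 : ρ G ∈ maximalIdeal (MvPowerSeries (Fin 3) K) ^ 2 :=
    ringEquiv_mem_maximalIdeal_pow ρ.toRingEquiv (Ideal.pow_le_pow_right hp2 hGmem)
  haveI : Module.Finite K (MvPowerSeries (Fin 3) K ⧸ tjurinaIdeal (ρ G)) := hτ
  obtain ⟨M, hM⟩ := exists_maximalIdeal_pow_le_of_finite_quotient (tjurinaIdeal (ρ G))
  have hyp : maximalIdeal (MvPowerSeries (Fin 3) K) ^ (M + 2) ≤
      maximalIdeal (MvPowerSeries (Fin 3) K) * Ideal.span {ρ G} +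
        maximalIdeal (MvPowerSeries (Fin 3) K) ^ 2 * jacobianIdeal (ρ G) := by
    have h1 : maximalIdeal (MvPowerSeries (Fin 3) K) ^ (M + 2) ≤ maximalIdeal (MvPowerSeries (Fin 3) K) ^ 2 * tjurinaIdeal (ρ G) := by
      rw [add_comm, pow_add]
      exact Ideal.mul_mono_right hM
    refine h1.trans ?_
    change _ * (Ideal.span {ρ G} ⊔ jacobianIdeal (ρ G)) ≤ _
    rw [Ideal.mul_sup]
    refine sup_le_sup_right ?_ _
    rw [pow_two, mul_assoc]
    exact Ideal.mul_le_left
  have hdet := isContactDetermined_of_pow_le (n := 3) (by norm_num) hρGne hρG2 hyp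
  set k := 2 * M + 2 - ord (ρ G) with hk
  -- the jet level `N = max (k + 1) (2p)` and the jet polynomial
  set N := max (k + 1) (2 * p) with hN
  set P : MvPolynomial (Fin 2) K := MvPowerSeries.truncTotal N F with hP
  set J : MvPowerSeries (Option (Fin 2)) K :=
    MvPowerSeries.X none ^ p + MvPowerSeries.rename (some : Fin 2 → Option (Fin 2)) (P : MvPowerSeries (Fin 2) K) with hJ
  have hjet : G - J ∈ maximalIdeal (MvPowerSeries (Option (Fin 2)) K) ^ (k + 1) := by
    have h1 : G - J = MvPowerSeries.rename (some : Fin 2 → Option (Fin 2)) (F - (P : MvPowerSeries (Fin 2) K)) := by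
      rw [hG, hJ, map_sub]; ring
    rw [h1]
    exact Ideal.pow_le_pow_right (le_max_left _ _) (rename_mem_pow_of_mem_pow (sub_truncTotal_mem_pow N F))
  obtain ⟨ψ, u, hu, hGψ⟩ := exists_unit_algEquiv_of_isContactDetermined hdet hjet
  -- the new Cohen coordinates `e' = ψ⁻¹ ∘ e`
  have hJfr : J = MvPowerSeries.X none ^ p + MvPolynomial.eval₂ MvPowerSeries.C
      (fun l : Fin 2 => if l = (0 : Fin 2) then MvPowerSeries.X (some (0 : Fin 2)) else MvPowerSeries.X (some 1)) P := by
    rw [hJ, MohWindowShadeFormalAnchor.eval₂_frame_eq_rename]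
  have hord := ordZero_truncTotal (N := N) hpF hF2 (le_max_right _ _)
  refine ⟨e.trans ψ.symm.toRingEquiv, f₀, ψ.symm w * ψ.symm u, P, deletePthPowers_truncTotal N hclean, hord.1, hord.2, hI,
    (hw.map ψ.symm).mul (hu.map ψ.symm), ?_⟩
  rw [RingEquiv.trans_apply, hE, ← hJfr]
  change ψ.symm (w * G) = _
  rw [map_mul, hGψ, map_mul, mul_assoc]
  congr 2
  exact ψ.symm_apply_apply J

end MohWindowShadeFormalSeries

end CampaignW46

end Summit.ResolutionOfSingularities.ResolutionOfSingularities.Theorems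

end
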